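import Literature.NumberTheory.Sieve.MoebiusShiftedPrimesProofs
import HarnessLib

/-!
# Möbius on shifted primes — the typical set with a free first exponent, and the corrected chain

Topic `Literature/NumberTheory/Sieve`.  Part of the decomposition of the named facts
`Literature.NumberTheory.Sieve.lichtman2020_moebius_shifted_primes_avg` and
`Literature.NumberTheory.Sieve.lichtman2020_moebius_shifted_primes_avg_power` (J. D. Lichtman,
*Averages of the Möbius function on shifted primes*, Q. J. Math. 73 (2022) 729–757,
doi:10.1093/qmath/haab054, arXiv:2009.08969v2 [Lichtman2020], Theorem 1.1; page numbers below
are PDF pages of the held copy `paper:arxiv-2009.08969`).  State of that decomposition in the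
tree: Theorem 1.1 (both parts) ⇐ Theorem 2.2 ⇐ Proposition 2.3 ⇐ Proposition 3.1 (PROVED,
`Lichtman2020_minorArcEstimate_holds`) + Proposition 3.2 ⇐ Proposition 3.4
(`Lichtman2020_liouvilleMeanSquare`, NAMED FACT, `MoebiusShiftedPrimesMajorArcs.lean`); in print
Proposition 3.4 ⇐ Proposition 5.1 + Lemmas 4.1, 4.6, 4.8 (p. 14) and Proposition 5.1 ⇐
Lemmas 4.1, 4.3, 4.4, 4.5, 4.7 (pp. 14–15).

## A gap in the printed proof of Proposition 5.1, and the repair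

All sets `S`, `S_d` of the paper are built ((2.3)–(2.4), p. 7) on
`[P₁, Q₁] = [(log X)^{33A}, (log X)^{ψ(X) - 4A}]`; the tree's `lichtmanTypical X A δ H` hard-wires the
exponent `33A`.  In the proof of Proposition 5.1 (p. 15, "Bound for `E₁`"), with `B = 11A`,
`α = 1/5`, `V = P₁^{1/3} = (log X)^B`, the paper bounds
`E₁ ≪ V log Q₁ ∑_{v ∈ ℐ₁} e^{-2αv/V} (T e^{v/V}/Y + 1)` (Lemma 4.1) and then sums the geometric
series as "`E₁ ≪ V log Q₁ · P₁^{-2α}/(1 - e^{-2α/V}) · (Q₁T/Y + 1) ≪ (log X)^{1-6α}(Q₁T/Y + 1)`,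
noting `V/(1 - e^{-2α/V}) = O(1)`".  But `1 - e^{-2α/V} ∼ 2α/V`, so `V/(1 - e^{-2α/V}) ∼ V²/(2α)`, not
`O(1)`: the honest bound is `E₁ ≍ V² P₁^{-2α} log Q₁ (Q₁T/Y + 1) = (log X)^{4B/5} log Q₁ (…)`, which
saves nothing.  (The same book-keeping with `V ≈ P₁^{1/6}`, `α ≈ 1/4` reproduces the saving
`P₁^{-1/6+η}` of Matomäki–Radziwiłł, Ann. of Math. 183 (2016), Proposition 1, from which the
argument is adapted.)  With `P₁ = (log X)^{33A}` fixed, optimising `V` (the error `1/V` of Lemma 4.7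
forces `V ≥ (log X)^B`) and `α < 1/4` (forced by the count of the well-spaced set `𝒲` via Lemma 4.4, p. 15)
yields a saving exponent `< 5.5A`, whereas the deduction of Proposition 3.4 (p. 14, last display:
the loss `Q₁/h₁ ≤ W`) needs `B ≥ 11A`, itself forced by the major-arc width `|θ| ≤ W⁴/(qH)` and the
bound `I_h ≪ qhX/W⁵` it requires (p. 10).
Hence Proposition 3.4 — and the tree's `Lichtman2020_liouvilleMeanSquare` — cannot be reached by
the printed method with the printed `P₁`.  Nothing is wrong with Theorem 1.1: the sets `S` are
internal, and NO step of §§2–5 uses an upper bound for `P₁` other than `P₁ ≤ Q₁` (checked: the sieve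
step (2.6) needs `log P₁/log Q₁ → 0`; Theorem 2.2 ⇐ Prop 2.3 needs `√W < P₁`; the minor arcs need
`P ≥ W^{33}/2`; the major arcs need `c ≤ W < P₁`; the count of `𝒲` improves with `P₁`).  The repair is
therefore to ENLARGE `P₁` to `(log X)^{cA}`: the bound `E₁ ≪ V² P₁^{-2α} log X (Q₁T/Y+1)
≤ (log X)^{22A + 1 - 2cA/5}(…)` is `≤ (log X)^{-11A}(…)` as soon as `2c/5 ≥ 33 + 1/A`, e.g. for every
`c ≥ 100` when `A > 5`.  (arXiv v2 of 20 Oct 2021 is the latest version; no erratum is known to us.)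

## Content

* `lichtmanTypicalWith c X A δ H` — DEFINITION: the typical-factorisation predicate of
  (2.3)–(2.4) with first interval `[P₁, Q₁] = [(log X)^{cA}, H/(log X)^{4A}]` (and the printed second
  interval); `lichtmanTypicalWith 33 = lichtmanTypical` (`lichtmanTypicalWith_thirtyThree`, `rfl`).
* `Lichtman2020_primeCharacterSum` — NAMED FACT: Lemma 4.5 (p. 12), the Vinogradov–Korobov bound
  for prime character polynomials `∑_{P ≤ p ≤ Q} χ(p) p^{-1-it}`, `P ≥ exp((log X)^θ)`, `θ > 2/3`.
* `Lichtman2020_liouvilleCharacterSifted` — NAMED FACT: Lemma 4.8 (p. 12), `∑_{m ≤ x, (m,𝒟)=1}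
  λ(m)χ(m) ≪_{A,K} x/(log x)^K` (fundamental lemma + Siegel–Walfisz).
* The CORRECTED internal statements along `S_c = lichtmanTypicalWith c`, `c ≥ 100`, each a copy of
  the tree's rendering of the printed statement with `lichtmanTypical` replaced by
  `lichtmanTypicalWith c` (and, for Proposition 5.1, the ranges its consumer uses — see its
  docstring): `Lichtman2020_dirichletMeanValueWith` (Proposition 5.1),
  `Lichtman2020_liouvilleMeanSquareWith` (Proposition 3.4), `Lichtman2020_keyFourierEstimateWith`
  (Theorem 2.2).  They are the targets of the re-targeted chain (Prop 5.1_c ⇐ Lemmas 4.5, 4.7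
  (= Matomäki–Radziwiłł Lemma 12, `MatomakiRadziwill2016_lemma12`), 4.3 (= MR Lemma 9,
  `MatomakiRadziwill2016_lemma9`), 4.4, 4.1; Prop 3.4_c ⇐ 5.1_c + 4.8 + 4.6 + 4.1; Thm 2.2_c ⇐
  3.1_c + (3.2_c ⇐ 3.4_c); Thm 1.1 ⇐ 2.2_c + (2.5)), recorded here so that the files proving those
  implications share one statement each.

## Faithfulness notes

* Lemma 4.5 is recorded as printed ("`≪_{A,K,θ}`" = `∃ C` after `A, K, θ`, uniform in `X ≥ 2`, `q`,
  `χ`, `P`, `Q`, `t`); its printed proof is "as with [MRshort] [Matomäki–Radziwiłł, *A note on the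
  Liouville function in short intervals*, arXiv:1502.02374, Lemma 2], except that the
  Vinogradov–Korobov zero-free region for `ζ(s)` is replaced by that of `L(s,χ)`" (`q ≤ (log X)^A`,
  the Siegel–Walfisz range, display (1.5) p. 4).
* Lemma 4.8 is recorded as printed, with `x ≥ 3` explicit (so that `log log x > 0`), `𝒫` a finite
  set `Ps` of primes in `(q, x^{1/log log x})` (any set of primes below a bound is finite), and
  "`(m, 𝒟) = 1`" spelled "no `p ∈ 𝒫` divides `m`".
* The three corrected statements deviate from print EXACTLY in (a) `P₁ = (log X)^{cA}`, `c ≥ 100`,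
  for the reason above, and (b) the deviations already documented at the tree's renderings they
  copy (`Lichtman2020_keyFourierEstimate`: regime `H ≤ exp((log X)^{2/3})`;
  `Lichtman2020_liouvilleMeanSquare`: range `Y ∈ [X/W⁶, X]`); Proposition 5.1_c in addition records
  the ranges `Y ∈ [X/W⁶, X]`, `0 ≤ T ≤ 2X` which the printed deduction of Proposition 3.4 actually
  uses (print: `Y ∈ [X^{1/2}, X²]`, `T ∈ [Y^{1/2}, Y]`, but the deduction on p. 14 applies it with
  `T` up to `X/2`, which exceeds `Y` for small `Y`), the lower limit `T₀ = (log X)^{2B} = (log X)^{22A}` and `B = 11A` of the print, and drops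
  the cut-off `n ≤ X/d` of `S_d` as all facts of this chain do (so `d` disappears).

## Sources

* J. D. Lichtman, arXiv:2009.08969v2: (2.3)–(2.4) p. 7; Prop 3.4 and the major arcs pp. 10–11;
  Lemmas 4.1–4.8 pp. 11–13; the deduction of Prop 3.4, Prop 5.1 and its proof pp. 14–15
  [Lichtman2020].
* K. Matomäki, M. Radziwiłł, Ann. of Math. (2) 183 (2016) 1015–1056, Lemmas 8, 9, 12, §8
  [MatomakiRadziwillAnnals2016].
-/

open Filter Asymptotics Finset MeasureTheory Complex
open scoped Topology

namespace Literature.NumberTheory.Sieve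

/-! ### The typical set with a free first exponent -/

/-- **Lichtman's typical factorisations with first interval `[(log X)^{cA}, H/(log X)^{4A}]`**:
`n` has a prime factor in `[P₁, Q₁] = [(log X)^{cA}, H/(log X)^{4A}]` and one in
`[P₂, Q₂] = [exp((log X)^{2/3+δ/2}), exp((log X)^{1-δ/2})]`.  For `c = 33` this is the printed set
`S(X,A,δ)` of (2.3)–(2.4) (`lichtmanTypical`, see `lichtmanTypicalWith_thirtyThree`); the chain of
this file uses `c ≥ 100` (module docstring).  A predicate on all of `ℕ` (the cut-off `n ≤ X` is
displayed in the sums), with the dependence on `H` explicit.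
[cite: Lichtman2020, (2.3)–(2.4)] -/
def lichtmanTypicalWith (c X A δ H : ℝ) (n : ℕ) : Prop :=
  HasPrimeFactorIn (Real.log X ^ (c * A)) (H / Real.log X ^ (4 * A)) n ∧
    HasPrimeFactorIn (Real.exp (Real.log X ^ (2 / 3 + δ / 2)))
      (Real.exp (Real.log X ^ (1 - δ / 2))) n

/-- `lichtmanTypicalWith c X A δ H` is decidable (classically). [folklore] -/
noncomputable instance lichtmanTypicalWith.decidablePred (c X A δ H : ℝ) :
    DecidablePred (lichtmanTypicalWith c X A δ H) := fun n => by
  unfold lichtmanTypicalWith; infer_instance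

/-- The printed set is the case `c = 33`: `lichtmanTypicalWith 33 = lichtmanTypical`.
[cite: Lichtman2020, (2.3)–(2.4)] -/
theorem lichtmanTypicalWith_thirtyThree (X A δ H : ℝ) :
    lichtmanTypicalWith 33 X A δ H = lichtmanTypical X A δ H := rfl

/-- Unfolding lemma. [folklore] -/
theorem lichtmanTypicalWith_iff (c X A δ H : ℝ) (n : ℕ) :
    lichtmanTypicalWith c X A δ H n ↔
      HasPrimeFactorIn (Real.log X ^ (c * A)) (H / Real.log X ^ (4 * A)) n ∧
        HasPrimeFactorIn (Real.exp (Real.log X ^ (2 / 3 + δ / 2)))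
          (Real.exp (Real.log X ^ (1 - δ / 2))) n := Iff.rfl

/-! ### Two printed inputs of §4 (named facts) -/

/-- NAMED FACT — **Lichtman 2020, Lemma 4.5** (Vinogradov–Korobov bound for prime character
polynomials), as printed (p. 12): "Given `A, K > 0`, `θ > 2/3`, and a Dirichlet character `χ` mod
`q ≤ (log X)^A`. Assume `exp((log X)^θ) ≤ P ≤ Q ≤ X`, and let `P(s,χ) = ∑_{P ≤ p ≤ Q} χ(p) p^{-s}`.
Then for any `|t| ≤ X`, `|P(1+it,χ)| ≪_{A,K,θ} log X/(1+|t|) + (log X)^{-K}`.  Proof. This follows as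
with [MRshort], except that the Vinogradov–Korobov zero-free region for `ζ(s)` is replaced by that
of `L(s,χ)`."  Rendering: the primes of `[P, Q]` are `(Icc ⌈P⌉₊ ⌊Q⌋₊).filter Nat.Prime`;
"`≪_{A,K,θ}`" is `∃ C` chosen after `A, K, θ`, uniform in `X ≥ 2`, `q ≥ 1`, `χ`, `P`, `Q`, `t`.
Users take `(h : Lichtman2020_primeCharacterSum)`. [cite: Lichtman2020, Lemma 4.5] -/
def Lichtman2020_primeCharacterSum : Prop :=
  ∀ A K θ : ℝ, 0 < A → 0 < K → 2 / 3 < θ → ∃ C : ℝ, ∀ X : ℝ, 2 ≤ X →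
    ∀ q : ℕ, 1 ≤ q → (q : ℝ) ≤ Real.log X ^ A → ∀ χ : DirichletCharacter ℂ q,
      ∀ P Q : ℝ, Real.exp (Real.log X ^ θ) ≤ P → P ≤ Q → Q ≤ X → ∀ t : ℝ, |t| ≤ X →
        ‖∑ p ∈ (Icc ⌈P⌉₊ ⌊Q⌋₊).filter Nat.Prime,
            χ (p : ZMod q) * (p : ℂ) ^ (-(1 + (t : ℂ) * I))‖
          ≤ C * (Real.log X / (1 + |t|) + Real.log X ^ (-K))

/-- NAMED FACT — **Lichtman 2020, Lemma 4.8** (fundamental lemma and Siegel–Walfisz for `λχ`), as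
printed (p. 12): "Given `A, K > 0`, `q ≤ (log x)^A`, Dirichlet character `χ` (mod `q`), and let
`𝒟 = ∏_{p ∈ 𝒫} p` for any set of primes `𝒫 ⊂ (q, x^{1/log log x})`. Then
`∑_{m ≤ x, (m,𝒟)=1} λ(m)χ(m) ≪_{A,K} x/(log x)^K`."  Rendering: `x ≥ 3` real (so that
`log log x > 0`); `𝒫` is a finite set `Ps` of primes `p` with `q < p < x^{1/log log x}`; "`(m, 𝒟) = 1`" is
"no `p ∈ 𝒫` divides `m`"; `λ` is Mathlib's `ArithmeticFunction.liouville`; "`≪_{A,K}`" is `∃ C` after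
`A, K`, uniform in `x`, `q`, `χ`, `𝒫`.  Users take `(h : Lichtman2020_liouvilleCharacterSifted)`.
[cite: Lichtman2020, Lemma 4.8] -/
def Lichtman2020_liouvilleCharacterSifted : Prop :=
  ∀ A K : ℝ, 0 < A → 0 < K → ∃ C : ℝ, ∀ x : ℝ, 3 ≤ x →
    ∀ q : ℕ, 1 ≤ q → (q : ℝ) ≤ Real.log x ^ A → ∀ χ : DirichletCharacter ℂ q,
      ∀ Ps : Finset ℕ,
        (∀ p ∈ Ps, p.Prime ∧ (q : ℝ) < p ∧ (p : ℝ) < x ^ (1 / Real.log (Real.log x))) →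
        ‖∑ m ∈ (Icc 1 ⌊x⌋₊).filter (fun m => ∀ p ∈ Ps, ¬ p ∣ m),
            ((ArithmeticFunction.liouville m : ℤ) : ℂ) * χ (m : ZMod q)‖
          ≤ C * x / Real.log x ^ K

/-! ### The corrected chain along `S_c`, `c ≥ 100` (named facts) -/

/-- NAMED FACT (corrected parameter, see the module docstring) — **Lichtman 2020, Proposition 5.1
along `S_c`, `c ≥ 100`.**  Printed (p. 14): "Given any `A > 5`, `δ > 0`, denote `B = 11A`. Write
`H = (log X)^{ψ(X)}` with `ψ(X) → ∞` and `ψ(X) ≤ (log X)^{2/3}`. Take `q ≤ (log X)^A`,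
`d < (log X)^{33A}`, a Dirichlet character `χ` (mod `q`), and let `S_d = S_d(X,A,δ)` as in (2.8). For
any `Y ∈ [X^{1/2}, X²]`, define `G(s) = ∑_{Y ≤ n ≤ 2Y, n ∈ S_d} λ(n)χ(n) n^{-s}`. Then for any
`T ∈ [Y^{1/2}, Y]`, we have `∫_{(log X)^{2B}}^{T} |G(1+it)|² dt ≪_{A,δ} (Q₁T/Y + 1)(log X)^{-B}`."
Rendering and deviations: `S_d` is `lichtmanTypicalWith c X A δ H` with `c ≥ 100` in place of the
printed `33` (the repair explained in the module docstring; the cut-off `n ≤ X/d` dropped as in all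
facts of this chain); `X : ℕ`, `H : ℕ → ℕ` under the standing assumptions of §3 as in
`Lichtman2020_liouvilleMeanSquare`; `Q₁ = H/(log X)^{4A}`, `B = 11A`, lower limit `(log X)^{22A}`;
the ranges `Y ∈ [X/(log X)^{6A}, X]` and `0 ≤ T ≤ 2X` are those in which the printed deduction of
Proposition 3.4 (p. 14) applies the proposition (for `T` below the lower limit the
oriented integral is `≤ 0` and the bound is trivial); "`≪_{A,δ}`" (uniform in `q, χ, Y, T`) is `∃ C`
chosen after `c, A, δ` and the function `H`, then `∀ᶠ X`.
Users take `(h : Lichtman2020_dirichletMeanValueWith)`. [cite: Lichtman2020, Proposition 5.1] -/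
def Lichtman2020_dirichletMeanValueWith : Prop :=
  ∀ c : ℝ, 100 ≤ c → ∀ A : ℝ, 5 < A → ∀ δ : ℝ, 0 < δ → ∀ H : ℕ → ℕ,
    Tendsto (fun X : ℕ => Real.log (H X) / Real.log (Real.log X)) atTop atTop →
    (∀ᶠ X : ℕ in atTop, (H X : ℝ) ≤ Real.exp (Real.log X ^ (2 / 3 : ℝ))) →
    ∃ C : ℝ, ∀ᶠ X : ℕ in atTop, ∀ q : ℕ, 1 ≤ q → (q : ℝ) ≤ Real.log X ^ A →
      ∀ χ : DirichletCharacter ℂ q, ∀ Y : ℝ, (X : ℝ) / Real.log X ^ (6 * A) ≤ Y → Y ≤ X →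
        ∀ T : ℝ, 0 ≤ T → T ≤ 2 * X →
          ∫ t in (Real.log X ^ (22 * A))..T,
              ‖∑ n ∈ (Icc ⌈Y⌉₊ ⌊2 * Y⌋₊).filter (lichtmanTypicalWith c X A δ (H X)),
                  ((ArithmeticFunction.liouville n : ℤ) : ℂ) * χ (n : ZMod q) *
                    (n : ℂ) ^ (-(1 + (t : ℂ) * I))‖ ^ 2
            ≤ C * (((H X : ℝ) / Real.log X ^ (4 * A)) * T / Y + 1) / Real.log X ^ (11 * A)

/-- NAMED FACT (corrected parameter, see the module docstring) — **Lichtman 2020, Proposition 3.4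
along `S_c`, `c ≥ 100`**: the statement `Lichtman2020_liouvilleMeanSquare` of
`MoebiusShiftedPrimesMajorArcs.lean` (Proposition 3.4, p. 10, with the range of `Y` recorded there as
`[X/W⁶, X]`) with `lichtmanTypical` replaced by `lichtmanTypicalWith c`, for every `c ≥ 100`.  In
print ⇐ Proposition 5.1 + Lemmas 4.1, 4.6, 4.8 (p. 14).
Users take `(h : Lichtman2020_liouvilleMeanSquareWith)`. [cite: Lichtman2020, Proposition 3.4] -/
def Lichtman2020_liouvilleMeanSquareWith : Prop :=
  ∀ c : ℝ, 100 ≤ c → ∀ A : ℝ, 5 < A → ∀ δ : ℝ, 0 < δ → ∀ H : ℕ → ℕ,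
    Tendsto (fun X : ℕ => Real.log (H X) / Real.log (Real.log X)) atTop atTop →
    (∀ᶠ X : ℕ in atTop, (H X : ℝ) ≤ Real.exp (Real.log X ^ (2 / 3 : ℝ))) →
    ∃ C : ℝ, ∀ᶠ X : ℕ in atTop, ∀ q : ℕ, 1 ≤ q → (q : ℝ) ≤ Real.log X ^ A →
      ∀ χ : DirichletCharacter ℂ q, ∀ h : ℕ,
        (H X : ℝ) / Real.log X ^ (5 * A) ≤ h → h ≤ H X →
        ∀ Y : ℝ, (X : ℝ) / Real.log X ^ (6 * A) ≤ Y → Y ≤ X →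
          ∫ x in Y..2 * Y,
              ‖∑ m ∈ (Icc ⌈x⌉₊ ⌊x + h⌋₊).filter (lichtmanTypicalWith c X A δ (H X)),
                  ((ArithmeticFunction.liouville m : ℤ) : ℂ) * χ (m : ZMod q)‖ ^ 2
            ≤ C * ((h : ℝ) ^ 2 * Y / Real.log X ^ (10 * A))

/-- NAMED FACT (corrected parameter, see the module docstring) — **Lichtman 2020, Theorem 2.2 along
`S_c`, `c ≥ 100`**: the statement `Lichtman2020_keyFourierEstimate` of
`MoebiusShiftedPrimesProofs.lean` (Theorem 2.2, p. 7, in the regime `H ≤ exp((log X)^{2/3})` recorded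
there) with `lichtmanTypical` replaced by `lichtmanTypicalWith c`, for every `c ≥ 100`.  In print ⇐
Propositions 2.3, 3.1, 3.2, 3.4 (pp. 8–11).  Theorem 1.1 follows from it and the sieve bound (2.5)
exactly as in `lichtman2020_moebius_shifted_primes_avg_of_keyFourierEstimate` (the sieve step only
needs `log P₁/log Q₁ → 0`).  Users take `(h : Lichtman2020_keyFourierEstimateWith)`.
[cite: Lichtman2020, Theorem 2.2] -/
def Lichtman2020_keyFourierEstimateWith : Prop :=
  ∀ c : ℝ, 100 ≤ c → ∀ A : ℝ, 5 < A → ∀ δ : ℝ, 0 < δ → ∀ H : ℕ → ℕ,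
    Tendsto (fun X : ℕ => Real.log (H X) / Real.log (Real.log X)) atTop atTop →
    (∀ᶠ X : ℕ in atTop, (H X : ℝ) ≤ Real.exp (Real.log X ^ (2 / 3 : ℝ))) →
    ∃ C : ℝ, ∀ᶠ X : ℕ in atTop, ∀ α : ℝ,
      ∫ x in (0 : ℝ)..X,
          ‖moebiusTwistedSum ((Icc ⌈x⌉₊ ⌊x + H X⌋₊).filter (lichtmanTypicalWith c X A δ (H X))) α‖
        ≤ C * ((H X : ℝ) * X / Real.log X ^ (A / 5))

end Literature.NumberTheory.Sieve
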